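import Literature.Probability.RandomPlanarGeometry.SAWStripPolygonLimit
import Literature.Probability.RandomPlanarGeometry.SAWStripPolygonWallBound
import Literature.Probability.RandomPlanarGeometry.SAWSlabPolygonLimit
import Literature.Probability.RandomPlanarGeometry.SAWTubeInsertionMargin
import Literature.Probability.Percolation.PlanarDuality
import Mathlib.Algebra.Order.Chebyshev
import HarnessLib

/-!
# Polygons in a planar strip versus walks in the half-height strip: `μ(S_h) ≤ μ_Polygon(S_{2h+1})`

Topic `Literature/Probability/RandomPlanarGeometry` (continues `SAWTubePolygons.lean`: `q̃_N(R) = Zd.tubePolygonCount`,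
`π(R) = Zd.tubePolygonRate`; `SAWStripPolygonLimit.lean`: rooted strip polygons as vertex lists `StripPolygonLimit.polyLists`,
`IsPolyList`, `card_polyLists`; `SAWTubeRenewal.lean`: the floor-to-floor bridges `𝓑_n⟨T⟩ = Zd.tubeBridges`,
`β_n⟨T⟩ = Zd.tubeBeta`; `SAWSlabPolygonLimit.lean`: `β_n⟨T⟩^{1/n} → μ⟨R⟩` (`tendsto_tubeBeta_rpow`,
`eventually_pow_le_tubeBeta`); companion of `SAWStripPolygonWallBound.lean`: `π(S_T) ≤ μ(S_{T-1})`).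

Source: N. Madras, G. Slade, *The Self-Avoiding Walk* (Birkhäuser 1993), §8.2, Theorem 8.2.2 (pp. 270–271; `q_N(R)`,
`μ_Polygon(R)`) and (8.2.7) `μ_Bridge⟨R⟩ = μ⟨R⟩` (p. 268). This file proves, for the planar strips
`S_T = ℤ × {0,…,T}`, the LOWER companion of the wall bound:

  **`μ(S_h) ≤ π(S_{2h+1})`** for every `h` (`Zd.tubeConnectiveConstant_le_tubePolygonRate_double`),

so that, with `SAWStripPolygonWallBound.lean`, `μ(S_h) ≤ μ_Polygon(S_{2h+1}) ≤ μ(S_{2h})`: the polygon constant of a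
strip is sandwiched between the WALK constants of the strips of (roughly) half and full height. Numerically
(Guttmann–Jensen, LNP 775 ch. 10, Table 10.1, pp. 237–238): `π(S_1) = 1 = μ(S_0)`, `π(S_3) = 1.6818 ≥ μ(S_1) = 1.6180`,
`π(S_5) = 1.9924 ≥ μ(S_2) ≈ 1.92` — the bound is rather tight. Label (lane literature cell, 2026-08-23): inequality
NOT LOCATED IN HELD PRINT; the two-walks-into-a-polygon gluing is the strip transplant of the printed `ℤ^d`
constructions (Madras–Slade Theorems 3.2.3–3.2.4, Corollary 3.2.5), and a shielding/gluing mechanism for polygons in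
slits is printed as prose in A. J. Guttmann, I. Jensen, LNP 775 ch. 10, §10.3 pp. 240–241 (after Alvarez–Janse van
Rensburg–Soteros–Whittington, J. Phys. A 41 (2008) 185004, Lemma 1); the primaries Soteros–Whittington 1988,
Alm–Janson 1990 and AJvRSW 2008 are not held by the lane (acquisition requests open). Scope: planar strips only
(`d = 2`, `k = 1`).

## The argument

Two floor-to-floor bridges `b₁, b₂ ∈ 𝓑_n⟨h⟩` of the strip `S_h` with the SAME span `M` are glued into a rooted
polygon of `S_{2h+1}` with `2n + 4h + 6` vertices: `b₁` in the rows `0..h` from `(0,0)` to `(M,0)`, the column `M+1`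
upwards, the reflection `y ↦ 2h+1-y` of `b₂` backwards in the rows `h+1..2h+1` from `(M, 2h+1)` to `(0, 2h+1)`, and the
column `-1` downwards back to `(-1, 0) ∼ (0,0)` (`glueList`, `isPolyList_glueList`); the gluing is injective
(`glueList_injOn`). By Cauchy–Schwarz over the `n+1` possible spans, `β_n⟨h⟩² ≤ (n+1) · q̃_{2n+4h+6}(S_{2h+1})`
(`sq_tubeBeta_le`), and `β_n⟨h⟩^{1/n} → μ(S_h)` gives the claim.

## References

* N. Madras, G. Slade, *The Self-Avoiding Walk*, Birkhäuser (1993), §8.2, Theorem 8.2.2 (pp. 270–271), eq. (8.2.7)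
  (p. 268). [MadrasSlade1993]
* A. J. Guttmann, I. Jensen, *The effect of confinement*, in *Polygons, Polyominoes and Polycubes*, LNP 775 (2009),
  ch. 10, Table 10.1 (pp. 237–238), §10.3 (pp. 240–241). [GuttmannJensen2009Confinement]
* N. Madras, G. Slade, op. cit., §3.2, Theorems 3.2.3–3.2.4, Corollary 3.2.5 (the `ℤ^d` two-walk polygon constructions).
-/

noncomputable section

open Filter Topology Finset Literature.Probability.LatticeModels Literature.Probability.Percolation SimpleGraph
open scoped BigOperators

namespace Literature.Probability.RandomPlanarGeometry.SAW.Zd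

namespace StripPolygonLower

open StripPolygonLimit

/-! ### Points, the reflection, bookkeeping for floor-to-floor strip bridges -/

/-- The point `(x, y)`. [folklore] -/
def pt (x y : ℤ) : Site 2 := ![x, y]

/-- First coordinate of `pt`. [folklore] -/
@[simp] private theorem pt_zero (x y : ℤ) : pt x y 0 = x := rfl
/-- Second coordinate of `pt`. [folklore] -/
@[simp] private theorem pt_one (x y : ℤ) : pt x y 1 = y := rfl

/-- The reflection `(x, y) ↦ (x, 2h+1-y)` taking the rows `0..h` to the rows `h+1..2h+1`. [folklore] -/
def vrefl (h : ℕ) (p : Site 2) : Site 2 := pt (p 0) (2 * h + 1 - p 1)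

/-- The reflection keeps the column. [folklore] -/
@[simp] private theorem vrefl_zero (h : ℕ) (p : Site 2) : vrefl h p 0 = p 0 := rfl
/-- The reflection on the height. [folklore] -/
@[simp] private theorem vrefl_one (h : ℕ) (p : Site 2) : vrefl h p 1 = 2 * h + 1 - p 1 := rfl

/-- Adjacency of points from their coordinates: horizontal neighbours. [folklore] -/
private theorem adj_of_right {x y : Site 2} (h0 : y 0 = x 0 + 1) (h1 : y 1 = x 1) : (zdGraph 2).Adj x y :=
  adj_of_stepKind (.right h0 h1)

/-- Adjacency of points from their coordinates: vertical neighbours. [folklore] -/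
private theorem adj_of_up {x y : Site 2} (h1 : y 1 = x 1 + 1) (h0 : y 0 = x 0) : (zdGraph 2).Adj x y :=
  adj_of_stepKind (.up h1 h0)

/-- The reflection preserves adjacency. [folklore] -/
private theorem vrefl_adj (h : ℕ) {x y : Site 2} (hxy : (zdGraph 2).Adj x y) : (zdGraph 2).Adj (vrefl h x) (vrefl h y) := by
  rcases stepKind_of_adj hxy with ⟨h0, h1⟩ | ⟨h0, h1⟩ | ⟨h1, h0⟩ | ⟨h1, h0⟩
  · exact adj_of_stepKind (.right (by simp only [vrefl_zero]; omega) (by simp only [vrefl_one]; omega))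
  · exact adj_of_stepKind (.left (by simp only [vrefl_zero]; omega) (by simp only [vrefl_one]; omega))
  · exact adj_of_stepKind (.down (by simp only [vrefl_one]; omega) (by simp only [vrefl_zero]; omega))
  · exact adj_of_stepKind (.up (by simp only [vrefl_one]; omega) (by simp only [vrefl_zero]; omega))

/-- The reflection is injective. [folklore] -/
private theorem vrefl_injective (h : ℕ) : Function.Injective (vrefl h) := fun x y hxy => by
  rw [Site.eq_iff_two] at hxy ⊢
  simp only [vrefl_zero, vrefl_one] at hxy
  exact ⟨hxy.1, by linarith [hxy.2]⟩

variable {h n : ℕ}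

/-- The facts about a floor-to-floor bridge of `S_h` used below. [cite: MadrasSlade1993, §8.2, proof of Theorem 8.2.1 (the class `𝓑_N⟨T⟩`, p. 270)] -/
private theorem bridge_facts {b : ℕ → Site 2} (hb : b ∈ tubeBridges 2 1 h n) :
    b 0 = 0 ∧ (∀ t, n ≤ t → b t = b n) ∧ (∀ t < n, (zdGraph 2).Adj (b t) (b (t + 1))) ∧ Set.InjOn b {t | t ≤ n} ∧
      (∀ t, 0 ≤ b t 1 ∧ b t 1 ≤ (h : ℤ)) ∧ (∀ t, 0 ≤ b t 0 ∧ b t 0 ≤ b n 0) ∧ b n 1 = 0 ∧ b n 0 ≤ (n : ℤ) := by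
  obtain ⟨hbr, hR, hfloor⟩ := mem_tubeBridges.1 hb
  obtain ⟨hs, hB⟩ := mem_bridges.1 hbr
  obtain ⟨h0, hfr, hadj, hinj⟩ := mem_saws.1 hs
  have hrow : ∀ t, 0 ≤ b t 1 ∧ b t 1 ≤ (h : ℤ) := fun t => by
    rcases le_or_gt t n with ht | ht
    · exact (hR t ht) 1 (by simp)
    · rw [hfr t ht.le]; exact (hR n le_rfl) 1 (by simp)
  have hcol : ∀ t, 0 ≤ b t 0 ∧ b t 0 ≤ b n 0 := fun t => by
    rcases Nat.eq_zero_or_pos t with rfl | ht0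
    · rw [h0]
      rcases Nat.eq_zero_or_pos n with rfl | hn0
      · simp [h0]
      · have := hB n hn0 le_rfl
        rw [h0] at this
        simp only [Pi.zero_apply] at this ⊢
        exact ⟨le_rfl, this.1.le⟩
    · rcases le_or_gt t n with ht | ht
      · have := hB t ht0 ht; rw [h0] at this; simp only [Pi.zero_apply] at this; exact ⟨this.1.le, this.2⟩
      · rw [hfr t ht.le]
        rcases Nat.eq_zero_or_pos n with rfl | hn0
        · simp [h0]
        · have := hB n hn0 le_rfl; rw [h0] at this; simp only [Pi.zero_apply] at this; exact ⟨this.1.le, le_rfl⟩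
  have hfl : b n 1 = 0 := by
    have := congrFun hfloor 1
    simpa [vproj] using this
  refine ⟨h0, hfr, hadj, hinj, hrow, hcol, hfl, ?_⟩
  have := abs_apply_le_of_adj h0 hadj n le_rfl 0
  exact (abs_le.1 this).2

/-! ### The glued polygon -/

/-- The vertex function of the glued polygon: `b₁` (`t ≤ n`), the column `M+1` upwards, the reflected `b₂` backwards,
the column `-1` downwards (`M` = the common span). [cite: MadrasSlade1993, Theorem 8.2.2 (this file's gluing)] -/
def glue (h n : ℕ) (b₁ b₂ : ℕ → Site 2) (t : ℕ) : Site 2 :=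
  if t ≤ n then b₁ t
  else if t ≤ n + 2 * h + 2 then pt (b₁ n 0 + 1) ((t : ℤ) - n - 1)
  else if t ≤ 2 * n + 2 * h + 3 then vrefl h (b₂ (2 * n + 2 * h + 3 - t))
  else pt (-1) (2 * n + 4 * h + 5 - (t : ℤ))

/-- The glued polygon as a vertex list (`2n + 4h + 6` vertices). [cite: MadrasSlade1993, Theorem 8.2.2 (this file's gluing)] -/
def glueList (h n : ℕ) (q : (ℕ → Site 2) × (ℕ → Site 2)) : List (Site 2) :=
  List.ofFn fun j : Fin (2 * n + 4 * h + 6) => glue h n q.1 q.2 j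

/-- Length of the glued list. [folklore] -/
@[simp] private theorem length_glueList (q : (ℕ → Site 2) × (ℕ → Site 2)) :
    (glueList h n q).length = 2 * n + 4 * h + 6 := by simp only [glueList, List.length_ofFn]

/-- Entries of the glued list. [folklore] -/
private theorem getElem_glueList (q : (ℕ → Site 2) × (ℕ → Site 2)) {j : ℕ} (hj : j < (glueList h n q).length) :
    (glueList h n q)[j] = glue h n q.1 q.2 j := by simp only [glueList, List.getElem_ofFn]

/-- Piece A (`t ≤ n`). [folklore] -/
private theorem glue_A {b₁ b₂ : ℕ → Site 2} {t : ℕ} (ht : t ≤ n) : glue h n b₁ b₂ t = b₁ t := by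
  simp [glue, ht]

/-- Piece B (`n < t ≤ n + 2h + 2`). [folklore] -/
private theorem glue_B {b₁ b₂ : ℕ → Site 2} {t : ℕ} (ht : n < t) (ht' : t ≤ n + 2 * h + 2) :
    glue h n b₁ b₂ t = pt (b₁ n 0 + 1) ((t : ℤ) - n - 1) := by
  simp [glue, not_le.2 ht, ht']

/-- Piece C (`n + 2h + 2 < t ≤ 2n + 2h + 3`). [folklore] -/
private theorem glue_C {b₁ b₂ : ℕ → Site 2} {t : ℕ} (ht : n + 2 * h + 2 < t) (ht' : t ≤ 2 * n + 2 * h + 3) :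
    glue h n b₁ b₂ t = vrefl h (b₂ (2 * n + 2 * h + 3 - t)) := by
  simp [glue, not_le.2 (show n < t by omega), not_le.2 ht, ht']

/-- Piece D (`2n + 2h + 3 < t`). [folklore] -/
private theorem glue_D {b₁ b₂ : ℕ → Site 2} {t : ℕ} (ht : 2 * n + 2 * h + 3 < t) :
    glue h n b₁ b₂ t = pt (-1) (2 * n + 4 * h + 5 - (t : ℤ)) := by
  simp [glue, not_le.2 (show n < t by omega), not_le.2 (show n + 2 * h + 2 < t by omega), not_le.2 ht]

/-- **The glued list is a rooted polygon of `S_{2h+1}`** when the two bridges have the same span.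
[cite: MadrasSlade1993, Theorem 8.2.2 (this file's gluing)] -/
theorem isPolyList_glueList {b₁ b₂ : ℕ → Site 2} (hb₁ : b₁ ∈ tubeBridges 2 1 h n) (hb₂ : b₂ ∈ tubeBridges 2 1 h n)
    (hM : b₁ n 0 = b₂ n 0) : IsPolyList (2 * h + 1) (glueList h n (b₁, b₂)) := by
  obtain ⟨h10, h1fr, h1adj, h1inj, h1row, h1col, h1fl, -⟩ := bridge_facts hb₁
  obtain ⟨h20, h2fr, h2adj, h2inj, h2row, h2col, h2fl, -⟩ := bridge_facts hb₂
  have hM0 : 0 ≤ b₁ n 0 := (h1col n).1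
  -- coordinates of the four pieces
  have hA : ∀ t, t ≤ n → 0 ≤ glue h n b₁ b₂ t 0 ∧ glue h n b₁ b₂ t 0 ≤ b₁ n 0 ∧ 0 ≤ glue h n b₁ b₂ t 1 ∧
      glue h n b₁ b₂ t 1 ≤ h := fun t ht => by
    rw [glue_A ht]; exact ⟨(h1col t).1, (h1col t).2, (h1row t).1, (h1row t).2⟩
  have hB : ∀ t, n < t → t ≤ n + 2 * h + 2 → glue h n b₁ b₂ t 0 = b₁ n 0 + 1 ∧ 0 ≤ glue h n b₁ b₂ t 1 ∧
      glue h n b₁ b₂ t 1 ≤ 2 * h + 1 := fun t ht ht' => by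
    rw [glue_B ht ht']; refine ⟨rfl, ?_, ?_⟩ <;> simp only [pt_one] <;> omega
  have hC : ∀ t, n + 2 * h + 2 < t → t ≤ 2 * n + 2 * h + 3 → 0 ≤ glue h n b₁ b₂ t 0 ∧ glue h n b₁ b₂ t 0 ≤ b₁ n 0 ∧
      (h : ℤ) + 1 ≤ glue h n b₁ b₂ t 1 ∧ glue h n b₁ b₂ t 1 ≤ 2 * h + 1 := fun t ht ht' => by
    rw [glue_C ht ht']
    have := h2col (2 * n + 2 * h + 3 - t); have := h2row (2 * n + 2 * h + 3 - t)
    simp only [vrefl_zero, vrefl_one]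
    refine ⟨?_, ?_, ?_, ?_⟩ <;> omega
  have hD : ∀ t, 2 * n + 2 * h + 3 < t → t ≤ 2 * n + 4 * h + 5 → glue h n b₁ b₂ t 0 = -1 ∧ 0 ≤ glue h n b₁ b₂ t 1 ∧
      glue h n b₁ b₂ t 1 ≤ 2 * h + 1 := fun t ht ht' => by
    rw [glue_D ht]; refine ⟨rfl, ?_, ?_⟩ <;> simp only [pt_one] <;> omega
  -- adjacency of consecutive vertices
  have hadj : ∀ t, t + 1 ≤ 2 * n + 4 * h + 5 → (zdGraph 2).Adj (glue h n b₁ b₂ t) (glue h n b₁ b₂ (t + 1)) := by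
    intro t ht
    rcases Nat.lt_or_ge t n with h1 | h1
    · rw [glue_A h1.le, glue_A (by omega)]; exact h1adj t h1
    rcases h1.eq_or_lt with h2 | h2
    · -- junction A | B
      subst h2
      rw [glue_A le_rfl, glue_B (by omega) (by omega)]
      exact adj_of_right (by simp) (by simp [h1fl])
    rcases Nat.lt_or_ge t (n + 2 * h + 2) with h3 | h3
    · rw [glue_B h2 h3.le, glue_B (by omega) (by omega)]
      exact adj_of_up (by simp; ring) (by simp)
    rcases h3.eq_or_lt with h4 | h4
    · -- junction B | C
      subst h4
      rw [glue_B h2 le_rfl, glue_C (by omega) (by omega), show 2 * n + 2 * h + 3 - (n + 2 * h + 2 + 1) = n by omega]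
      refine adj_of_stepKind (.left ?_ ?_)
      · simp [hM]
      · simp [h2fl]; ring
    rcases Nat.lt_or_ge t (2 * n + 2 * h + 3) with h5 | h5
    · rw [glue_C h4 h5.le, glue_C (by omega) (by omega)]
      have e : 2 * n + 2 * h + 3 - t = (2 * n + 2 * h + 3 - (t + 1)) + 1 := by omega
      rw [e]
      exact (vrefl_adj h (h2adj _ (by omega))).symm
    rcases h5.eq_or_lt with h6 | h6
    · -- junction C | D
      subst h6
      rw [glue_C h4 le_rfl, Nat.sub_self, glue_D (by omega), h20]
      refine adj_of_stepKind (.left ?_ ?_)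
      · simp
      · simp; ring
    · rw [glue_D h6, glue_D (by omega)]
      exact adj_of_stepKind (.down (by simp; ring) (by simp))
  -- injectivity on `[0, 2n+4h+5]`
  have hinj : ∀ s t, s ≤ 2 * n + 4 * h + 5 → t ≤ 2 * n + 4 * h + 5 → glue h n b₁ b₂ s = glue h n b₁ b₂ t → s = t := by
    -- it suffices to treat `s < t`
    suffices key : ∀ s t, s < t → t ≤ 2 * n + 4 * h + 5 → glue h n b₁ b₂ s ≠ glue h n b₁ b₂ t by
      intro s t hs ht hst
      by_contra hne
      rcases Nat.lt_or_gt_of_ne hne with hlt | hlt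
      · exact key s t hlt ht hst
      · exact key t s hlt hs hst.symm
    intro s t hst ht heq
    have hc := congrFun heq 0
    have hr := congrFun heq 1
    -- classify `s` and `t` by pieces
    rcases le_or_gt s n with hsA | hsA
    · have hs' := hA s hsA
      rcases le_or_gt t n with htA | htA
      · rw [glue_A hsA, glue_A htA] at heq
        have := h1inj (show s ≤ n from hsA) (show t ≤ n from htA) heq; omega
      rcases le_or_gt t (n + 2 * h + 2) with htB | htB
      · have := hB t htA htB; omega
      rcases le_or_gt t (2 * n + 2 * h + 3) with htC | htC
      · have := hC t htB htC; omega
      · have := hD t htC ht; omega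
    rcases le_or_gt s (n + 2 * h + 2) with hsB | hsB
    · have hs' := hB s hsA hsB
      rcases le_or_gt t (n + 2 * h + 2) with htB | htB
      · rw [glue_B hsA hsB, glue_B (by omega) htB] at hr; simp at hr; omega
      rcases le_or_gt t (2 * n + 2 * h + 3) with htC | htC
      · have := hC t htB htC; omega
      · have := hD t htC ht; omega
    rcases le_or_gt s (2 * n + 2 * h + 3) with hsC | hsC
    · have hs' := hC s hsB hsC
      rcases le_or_gt t (2 * n + 2 * h + 3) with htC | htC
      · rw [glue_C hsB hsC, glue_C (by omega) htC] at heq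
        have h1 := vrefl_injective h heq
        have := h2inj (show 2 * n + 2 * h + 3 - s ≤ n by omega)
          (show 2 * n + 2 * h + 3 - t ≤ n by omega) h1
        omega
      · have := hD t htC ht; omega
    · have hs' := hD s hsC (by omega)
      have := hD t (by omega) ht
      rw [glue_D hsC, glue_D (by omega)] at hr; simp at hr; omega
  -- assemble the structure
  have hlen : (glueList h n (b₁, b₂)).length = 2 * n + 4 * h + 6 := length_glueList _
  refine ⟨by rw [hlen]; omega, ?_, ?_, fun v hv => ?_, fun a ha c hc => ?_, fun a ha => ?_⟩
  · rw [List.isChain_iff_getElem]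
    intro i hi
    rw [hlen] at hi
    rw [getElem_glueList, getElem_glueList]
    exact hadj i (by omega)
  · rw [List.nodup_iff_injective_getElem]
    intro i j hij
    simp only [getElem_glueList] at hij
    exact Fin.ext (hinj i j (by have := lt_of_lt_of_eq i.isLt hlen; omega)
      (by have := lt_of_lt_of_eq j.isLt hlen; omega) hij)
  · rw [List.mem_iff_getElem] at hv
    obtain ⟨i, hi, rfl⟩ := hv
    rw [hlen] at hi
    rw [getElem_glueList]
    simp only
    rcases le_or_gt i n with h1 | h1
    · have := hA i h1; push_cast; omega
    rcases le_or_gt i (n + 2 * h + 2) with h2 | h2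
    · have := hB i h1 h2; push_cast; omega
    rcases le_or_gt i (2 * n + 2 * h + 3) with h3 | h3
    · have := hC i h2 h3; push_cast; omega
    · have := hD i h3 (by omega); push_cast; omega
  · rw [List.head?_eq_getElem?, List.getElem?_eq_getElem (by rw [hlen]; omega), Option.mem_def, Option.some.injEq] at ha
    rw [List.getLast?_eq_getElem?, hlen, List.getElem?_eq_getElem (by rw [hlen]; omega), Option.mem_def,
      Option.some.injEq] at hc
    subst ha; subst hc
    rw [getElem_glueList, getElem_glueList]
    simp only
    rw [show 2 * n + 4 * h + 6 - 1 = 2 * n + 4 * h + 5 by omega, glue_D (by omega), glue_A (Nat.zero_le _), h10]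
    exact adj_of_stepKind (.right (by simp) (by simp))
  · rw [List.head?_eq_getElem?, List.getElem?_eq_getElem (by rw [hlen]; omega), Option.mem_def, Option.some.injEq] at ha
    subst ha
    rw [getElem_glueList]
    simp only
    rw [glue_A (Nat.zero_le _), h10]; rfl

/-- **The gluing is injective** on pairs of floor-to-floor bridges of `S_h`.
[cite: MadrasSlade1993, Theorem 8.2.2 (this file's gluing)] -/
theorem glueList_injOn :
    Set.InjOn (glueList h n) ((tubeBridges 2 1 h n ×ˢ tubeBridges 2 1 h n : Finset _) : Set _) := by
  rintro ⟨b₁, b₂⟩ hb ⟨b₁', b₂'⟩ hb' heq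
  rw [Finset.mem_coe, Finset.mem_product] at hb hb'
  obtain ⟨-, h1fr, -⟩ := bridge_facts hb.1
  obtain ⟨-, h2fr, -⟩ := bridge_facts hb.2
  obtain ⟨-, h1fr', -⟩ := bridge_facts hb'.1
  obtain ⟨-, h2fr', -⟩ := bridge_facts hb'.2
  have hpt : ∀ t, t < 2 * n + 4 * h + 6 → glue h n b₁ b₂ t = glue h n b₁' b₂' t := fun t ht => by
    have := congrArg (fun L : List (Site 2) => L[t]?) heq
    simp only [glueList, List.getElem?_ofFn] at this
    simpa [ht] using this
  have e1 : ∀ t, t ≤ n → b₁ t = b₁' t := fun t ht => by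
    have := hpt t (by omega); rwa [glue_A ht, glue_A ht] at this
  have e2 : ∀ s, s ≤ n → b₂ s = b₂' s := fun s hs => by
    have := hpt (2 * n + 2 * h + 3 - s) (by omega)
    rw [glue_C (by omega) (by omega), glue_C (by omega) (by omega),
      show 2 * n + 2 * h + 3 - (2 * n + 2 * h + 3 - s) = s by omega] at this
    exact vrefl_injective h this
  refine Prod.ext (funext fun t => ?_) (funext fun t => ?_)
  · rcases le_or_gt t n with ht | ht
    · exact e1 t ht
    · rw [h1fr t ht.le, h1fr' t ht.le]; exact e1 n le_rfl
  · rcases le_or_gt t n with ht | ht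
    · exact e2 t ht
    · rw [h2fr t ht.le, h2fr' t ht.le]; exact e2 n le_rfl

/-! ### Counting: `β_n⟨h⟩² ≤ (n+1) q̃_{2n+4h+6}(S_{2h+1})` -/

/-- The pairs of floor-to-floor bridges of `S_h` with equal spans. [cite: MadrasSlade1993, Theorem 8.2.2 (this file's gluing)] -/
def eqSpanPairs (h n : ℕ) : Finset ((ℕ → Site 2) × (ℕ → Site 2)) :=
  (tubeBridges 2 1 h n ×ˢ tubeBridges 2 1 h n).filter fun q => q.1 n 0 = q.2 n 0

/-- The pairs with equal spans inject into the rooted polygons of `S_{2h+1}` with `2n+4h+6` vertices.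
[cite: MadrasSlade1993, Theorem 8.2.2 (this file's gluing)] -/
theorem card_eqSpanPairs_le : (eqSpanPairs h n).card ≤ tubePolygonCount 2 1 (2 * h + 1) (2 * n + 4 * h + 6) := by
  rw [← card_polyLists]
  refine Finset.card_le_card_of_injOn (glueList h n) (fun q hq => ?_) (glueList_injOn.mono fun q hq => ?_)
  · rw [Finset.mem_coe, eqSpanPairs, Finset.mem_filter, Finset.mem_product] at hq
    obtain ⟨⟨hb₁, hb₂⟩, hM⟩ := hq
    exact Finset.mem_coe.2 (mem_polyLists.2 ⟨isPolyList_glueList hb₁ hb₂ hM, length_glueList _⟩)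
  · rw [Finset.mem_coe, eqSpanPairs, Finset.mem_filter] at hq
    exact Finset.mem_coe.2 hq.1

/-- **`β_n⟨h⟩² ≤ (n+1) q̃_{2n+4h+6}(S_{2h+1})`** (Cauchy–Schwarz over the `n+1` spans).
[cite: MadrasSlade1993, Theorem 8.2.2 (this file's gluing)] -/
theorem sq_tubeBeta_le (h n : ℕ) :
    tubeBeta 2 1 h n ^ 2 ≤ (n + 1) * tubePolygonCount 2 1 (2 * h + 1) (2 * n + 4 * h + 6) := by
  classical
  set B := tubeBridges 2 1 h n with hB
  set f : ℕ → ℕ := fun M => (B.filter fun b => b n 0 = (M : ℤ)).card with hf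
  -- `β = Σ_M f M`
  have hspan : ∀ b ∈ B, (b n 0).toNat ∈ Finset.range (n + 1) ∧ ((b n 0).toNat : ℤ) = b n 0 := fun b hb => by
    obtain ⟨-, -, -, -, -, hcol, -, hle⟩ := bridge_facts hb
    have h0 := (hcol n).1
    refine ⟨Finset.mem_range.2 ?_, Int.toNat_of_nonneg h0⟩
    have : (b n 0).toNat ≤ n := by rw [Int.toNat_le]; exact hle
    omega
  have hsum : tubeBeta 2 1 h n = ∑ M ∈ Finset.range (n + 1), f M := by
    rw [tubeBeta, ← hB, Finset.card_eq_sum_card_fiberwise (f := fun b : ℕ → Site 2 => (b n 0).toNat)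
      (t := Finset.range (n + 1)) (fun b hb => (hspan b hb).1)]
    refine Finset.sum_congr rfl fun M _ => ?_
    rw [hf]
    congr 1
    ext b
    simp only [Finset.mem_filter, and_congr_right_iff]
    intro hb
    constructor
    · intro hM; rw [← hM, (hspan b hb).2]
    · intro hM; rw [hM]; simp
  -- `Σ_M f M ^ 2 ≤ #eqSpanPairs`
  have hsq : ∑ M ∈ Finset.range (n + 1), f M ^ 2 ≤ (eqSpanPairs h n).card := by
    have hdisj : Set.PairwiseDisjoint (↑(Finset.range (n + 1)) : Set ℕ)
        (fun M => (B.filter fun b => b n 0 = (M : ℤ)) ×ˢ (B.filter fun b => b n 0 = (M : ℤ))) := by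
      intro M _ M' _ hMM'
      rw [Function.onFun, Finset.disjoint_left]
      rintro ⟨b₁, b₂⟩ h1 h2
      rw [Finset.mem_product, Finset.mem_filter, Finset.mem_filter] at h1 h2
      have : (M : ℤ) = M' := h1.1.2.symm.trans h2.1.2
      exact hMM' (by exact_mod_cast this)
    calc ∑ M ∈ Finset.range (n + 1), f M ^ 2
        = ∑ M ∈ Finset.range (n + 1), ((B.filter fun b => b n 0 = (M : ℤ)) ×ˢ (B.filter fun b => b n 0 = (M : ℤ))).card := by
          refine Finset.sum_congr rfl fun M _ => ?_; rw [Finset.card_product, hf, sq]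
      _ = ((Finset.range (n + 1)).biUnion fun M =>
            (B.filter fun b => b n 0 = (M : ℤ)) ×ˢ (B.filter fun b => b n 0 = (M : ℤ))).card :=
          (Finset.card_biUnion hdisj).symm
      _ ≤ (eqSpanPairs h n).card := by
          refine Finset.card_le_card fun q hq => ?_
          rw [Finset.mem_biUnion] at hq
          obtain ⟨M, -, hM⟩ := hq
          rw [Finset.mem_product, Finset.mem_filter, Finset.mem_filter] at hM
          rw [eqSpanPairs, Finset.mem_filter, Finset.mem_product]
          exact ⟨⟨hM.1.1, hM.2.1⟩, hM.1.2.trans hM.2.2.symm⟩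
  -- Cauchy–Schwarz
  have hcs : (∑ M ∈ Finset.range (n + 1), f M) ^ 2 ≤ (Finset.range (n + 1)).card * ∑ M ∈ Finset.range (n + 1), f M ^ 2 :=
    sq_sum_le_card_mul_sum_sq
  rw [Finset.card_range] at hcs
  rw [hsum]
  exact hcs.trans (Nat.mul_le_mul_left _ (hsq.trans card_eqSpanPairs_le))

/-! ### Analysis -/

/-- From `β_n⟨h⟩² ≤ (n+1) q̃_{2n+4h+6}` and `β_n⟨h⟩^{1/n} → μ(S_h)`: for `a < μ(S_h)`, eventually (in `n`)
`a^{2n+4h+6} ≤ q̃_{2n+4h+6}(S_{2h+1})`. [cite: MadrasSlade1993, Theorem 8.2.2 (this file's gluing); §8.2, eq. (8.2.7)] -/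
theorem eventually_pow_le_tubePolygonCount (h : ℕ) {a : ℝ} (ha0 : 0 < a) (ha : a < tubeConnectiveConstant 2 1 h) :
    ∀ᶠ n : ℕ in atTop, a ^ (2 * n + 4 * h + 6) ≤ (tubePolygonCount 2 1 (2 * h + 1) (2 * n + 4 * h + 6) : ℝ) := by
  -- an intermediate rate `a < a' < μ(S_h)`
  set a' := (a + tubeConnectiveConstant 2 1 h) / 2 with ha'
  have haa' : a < a' := by rw [ha']; linarith
  have ha'μ : a' < tubeConnectiveConstant 2 1 h := by rw [ha']; linarith
  have ha'0 : 0 < a' := ha0.trans haa'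
  have hev := eventually_pow_le_tubeBeta (d := 2) (k := 1) le_rfl h ha'0.le ha'μ
  -- `(n+1) (a/a')^{2n} a^{4h+6} → 0`
  have hr : |(a / a') ^ 2| < 1 := by
    rw [abs_of_nonneg (by positivity)]
    exact pow_lt_one₀ (by positivity) ((div_lt_one ha'0).2 haa') two_ne_zero
  have hlim : Tendsto (fun n : ℕ => a ^ (4 * h + 6) * 2 * ((n : ℝ) ^ 1 * ((a / a') ^ 2) ^ n)) atTop (𝓝 0) := by
    have := (tendsto_pow_const_mul_const_pow_of_abs_lt_one 1 hr).const_mul (a ^ (4 * h + 6) * 2)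
    rwa [mul_zero] at this
  filter_upwards [hev, (tendsto_order.1 hlim).2 1 one_pos, eventually_ge_atTop 1] with n hn hsmall hn1
  have hq := sq_tubeBeta_le h n
  have hq' : (tubeBeta 2 1 h n : ℝ) ^ 2 ≤ ((n : ℝ) + 1) * tubePolygonCount 2 1 (2 * h + 1) (2 * n + 4 * h + 6) := by
    exact_mod_cast hq
  have h1 : a' ^ (2 * n) ≤ (tubeBeta 2 1 h n : ℝ) ^ 2 := by
    rw [mul_comm, pow_mul]
    exact pow_le_pow_left₀ (by positivity) hn 2
  -- `a^{2n+4h+6} (n+1) ≤ a'^{2n}`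
  have hn1' : (1 : ℝ) ≤ n := by exact_mod_cast hn1
  have h2 : a ^ (2 * n + 4 * h + 6) * ((n : ℝ) + 1) ≤ a' ^ (2 * n) := by
    have key : a ^ (2 * n) = ((a / a') ^ 2) ^ n * a' ^ (2 * n) := by
      rw [pow_mul, pow_mul, ← mul_pow]
      congr 1
      field_simp
    have e : a ^ (2 * n + 4 * h + 6) * ((n : ℝ) + 1) = (a ^ (4 * h + 6) * ((n : ℝ) + 1) * ((a / a') ^ 2) ^ n) * a' ^ (2 * n) := by
      rw [show 2 * n + 4 * h + 6 = 2 * n + (4 * h + 6) by ring, pow_add, key]; ring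
    rw [e]
    have h3 : a ^ (4 * h + 6) * ((n : ℝ) + 1) * ((a / a') ^ 2) ^ n ≤ 1 := by
      calc a ^ (4 * h + 6) * ((n : ℝ) + 1) * ((a / a') ^ 2) ^ n
          ≤ a ^ (4 * h + 6) * (2 * n) * ((a / a') ^ 2) ^ n := by gcongr; linarith
        _ = a ^ (4 * h + 6) * 2 * ((n : ℝ) ^ 1 * ((a / a') ^ 2) ^ n) := by ring
        _ ≤ 1 := hsmall.le
    calc (a ^ (4 * h + 6) * ((n : ℝ) + 1) * ((a / a') ^ 2) ^ n) * a' ^ (2 * n) ≤ 1 * a' ^ (2 * n) :=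
          mul_le_mul_of_nonneg_right h3 (by positivity)
      _ = a' ^ (2 * n) := one_mul _
  have hN0 : (0 : ℝ) < (n : ℝ) + 1 := by positivity
  have := (h2.trans h1).trans hq'
  rw [mul_comm ((n : ℝ) + 1)] at this
  exact le_of_mul_le_mul_right this hN0

end StripPolygonLower

/-! ### The theorem -/

section Theorems

open StripPolygonLower

/-- **Walks in `S_h` versus polygons in `S_{2h+1}`: `μ(S_h) ≤ π(S_{2h+1})`** for every `h` — the connective constant of
the self-avoiding walks of the strip `ℤ × {0,…,h}` is at most the (upper) growth rate of the self-avoiding polygons of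
the strip of height `2h+1` (two equal-span floor-to-floor bridges of `S_h` glue to a polygon of `S_{2h+1}`).
Companion of `tubePolygonRate_le_tubeConnectiveConstant_pred` (`π(S_T) ≤ μ(S_{T-1})`, `SAWStripPolygonWallBound.lean`).
[cite: MadrasSlade1993, Theorem 8.2.2 (b) p. 271 and Theorem 8.2.1 p. 269 (context; this bound is not printed there)]
[cite: GuttmannJensen2009Confinement, §10.3 pp. 240–241 (shielding/gluing mechanism for polygons in slits, Lemma 1 of Alvarez–Janse van Rensburg–Soteros–Whittington 2008)] -/
theorem tubeConnectiveConstant_le_tubePolygonRate_double (h : ℕ) :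
    tubeConnectiveConstant 2 1 h ≤ tubePolygonRate 2 1 (2 * h + 1) := by
  refine le_of_forall_lt_imp_le_of_dense fun a ha => ?_
  -- WLOG `a > 0`
  have hμ1 : 1 ≤ tubePolygonRate 2 1 (2 * h + 1) := TubePolygon.one_le_tubePolygonRate (d := 0) (by omega)
  rcases le_or_gt a 0 with ha0 | ha0
  · linarith
  have hev := eventually_pow_le_tubePolygonCount h ha0 ha
  -- along `N = n + 2h + 2` the root sequence is `≥ a`
  have hbdd : IsBoundedUnder (· ≤ ·) atTop
      (fun N : ℕ => (tubePolygonCount 2 1 (2 * h + 1) (2 * N + 2) : ℝ) ^ (1 / (2 * (N : ℝ) + 2))) :=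
    TubePolygon.isBoundedUnder_polygon (d := 0) (2 * h + 1)
  unfold tubePolygonRate
  refine Filter.le_limsup_of_frequently_le ?_ hbdd
  rw [Filter.frequently_atTop]
  intro N₀
  obtain ⟨n₀, hn₀⟩ := Filter.eventually_atTop.1 hev
  refine ⟨max N₀ n₀ + 2 * h + 2, by omega, ?_⟩
  set n := max N₀ n₀ with hn
  have hnn : n₀ ≤ n := le_max_right _ _
  have e1 : 2 * (n + 2 * h + 2) + 2 = 2 * n + 4 * h + 6 := by ring
  have e2 : (2 * ((n + 2 * h + 2 : ℕ) : ℝ) + 2) = ((2 * n + 4 * h + 6 : ℕ) : ℝ) := by push_cast; ring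
  rw [e1, e2]
  calc a = (a ^ (2 * n + 4 * h + 6)) ^ (1 / ((2 * n + 4 * h + 6 : ℕ) : ℝ)) := by
        rw [one_div, Real.pow_rpow_inv_natCast ha0.le (by omega)]
    _ ≤ ((tubePolygonCount 2 1 (2 * h + 1) (2 * n + 4 * h + 6) : ℕ) : ℝ) ^ (1 / ((2 * n + 4 * h + 6 : ℕ) : ℝ)) :=
        Real.rpow_le_rpow (by positivity) (hn₀ n hnn) (by positivity)

/-- **The sandwich `μ(S_h) ≤ π(S_{2h+1}) ≤ μ(S_{2h})`**: the polygon constant of the strip of height `2h+1` lies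
between the walk constants of the strips of heights `h` and `2h` (this file's lower bound and the wall bound
`tubePolygonRate_le_tubeConnectiveConstant_pred` of `SAWStripPolygonWallBound.lean`).
[cite: MadrasSlade1993, Theorem 8.2.2 (pp. 270–271; this file and `SAWStripPolygonWallBound.lean`: two-sided comparison)] -/
theorem tubeConnectiveConstant_le_tubePolygonRate_le (h : ℕ) :
    tubeConnectiveConstant 2 1 h ≤ tubePolygonRate 2 1 (2 * h + 1) ∧
      tubePolygonRate 2 1 (2 * h + 1) ≤ tubeConnectiveConstant 2 1 (2 * h) := by
  refine ⟨tubeConnectiveConstant_le_tubePolygonRate_double h, ?_⟩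
  have := tubePolygonRate_le_tubeConnectiveConstant_pred (T := 2 * h + 1) (by omega)
  simpa using this

/-- **Every strip: `μ(S_{⌊(T-1)/2⌋}) ≤ π(S_T)`** (`T ≥ 1`) — the lower bound for odd heights and the monotonicity of
`π` in the height (`TubeInsertion.tubePolygonRate_lt_succ`, `SAWTubeInsertionMargin.lean`) for even heights.
[cite: MadrasSlade1993, Theorem 8.2.2 (pp. 270–271; this file's lower comparison)] -/
theorem tubeConnectiveConstant_half_le_tubePolygonRate {T : ℕ} (hT : 1 ≤ T) :
    tubeConnectiveConstant 2 1 ((T - 1) / 2) ≤ tubePolygonRate 2 1 T := by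
  have h1 := tubeConnectiveConstant_le_tubePolygonRate_double ((T - 1) / 2)
  rcases Nat.even_or_odd (T - 1) with he | ho
  · -- `T = 2h + 1`
    have e : 2 * ((T - 1) / 2) + 1 = T := by obtain ⟨k, hk⟩ := he; omega
    rwa [e] at h1
  · -- `T = 2h + 2`
    have e : 2 * ((T - 1) / 2) + 1 + 1 = T := by obtain ⟨k, hk⟩ := ho; omega
    have h2 := TubeInsertion.tubePolygonRate_lt_succ (d := 0) (L := 2 * ((T - 1) / 2) + 1) (by omega)
    rw [e] at h2
    exact h1.trans h2.le

/-- **A numeric locality rate for strip POLYGONS**: `log μ(ℤ²) - log π(S_T) ≤ 45 / √⌊(T-1)/2⌋` for `T ≥ 3` — the lower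
comparison with the half-height strip and the tree's strip locality rate
`log μ(ℤ²) - log μ(S_h) ≤ 45/√h` (`log_sub_log_stripConnectiveConstant_le`, `SAWTubeLocality.lean`).
[cite: MadrasSlade1993, Theorem 8.2.1, eq. (8.2.12) and Theorem 8.2.2 (polygon analogue, explicit; this file)] -/
theorem log_connectiveConstant_sub_log_tubePolygonRate_le {T : ℕ} (hT : 3 ≤ T) :
    Real.log (connectiveConstant 2) - Real.log (tubePolygonRate 2 1 T) ≤ 45 / Real.sqrt (((T - 1) / 2 : ℕ) : ℝ) := by
  have hh : 1 ≤ (T - 1) / 2 := by omega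
  have h1 := (log_sub_log_stripConnectiveConstant_le hh).2
  have h2 := tubeConnectiveConstant_half_le_tubePolygonRate (T := T) (by omega)
  have hpos : 0 < tubeConnectiveConstant 2 1 ((T - 1) / 2) := tubeConnectiveConstant_pos (d := 2) le_rfl _
  have h3 := Real.log_le_log hpos h2
  linarith

end Theorems

end Literature.Probability.RandomPlanarGeometry.SAW.Zd

end
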